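import Mathlib
import HarnessLib
import Summits.CriticalPhenomena.PercolationContinuityZ3.Theorems.PercNearOneGluingNoHeavyQuantFarCoreStepChain
import Summits.CriticalPhenomena.PercolationContinuityZ3.Theorems.PercNearOneGluingNoHeavyQuantFarDecLawDefs

/-!
# QUANT lane R8, front "FAR beyond trees", layer one — block-locality for ARBITRARY pendant cores, file 2:
# the law-level numbers of a PARTIALLY DECOUPLED core law and the reduction of `hdom` to the one-vertex steps (A), (B)

builds on p205010 (kernel theorem, internal audit signed; external expert review pending)

Support file (`--supports stmt-CriticalPhenomena-4575`), seat `prim-quant-p1` (gen 23); memo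
`run/shared/lean/prim/quant/prim-quant-p1-g23/FOR-LEAD-CORESTEP.md` §2–§3.  Standard axioms; no sorries.

SETTING (law level, the objects of `Block.farLayerOne_hubFamily_law`, p1 g22).  Anchors are indexed by `J : Finset ℕ`; the CORE REACH LAW is
`ρ : Finset ℕ → ℝ` (`ρ R` = probability that exactly the anchors `R ⊆ J` are joined to the cut vertex through the core); anchor `j` carries an
independent hub count with `P(W_j = 0) = z j`, `P(W_j = 1) = s j`, `P(W_j ≥ 1) = u j`, and has core marginal `m j`.  For a set `D` of DECOUPLED
anchors (their membership replaced by independent `Bern(m j)` stems) the block count is `X_D = Σ_{j ∈ R∖D} W_j + Σ_{j ∈ D} ε_j W_j`, and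

* `Block.claw0 J ρ z u m D = P(X_D = 0) = [Σ_R ρ R ∏_{j∈R∖D} z j]·∏_{j∈D}(1 − m j u j)`,
* `Block.claw1 J ρ z s u m D = P(X_D = 1) = [Σ_R ρ R ∏_{R∖D} z]·[Σ_{i∈D} m i s i ∏_{D∖i}(1 − m u)] + [Σ_R ρ R Σ_{i∈R∖D} s i ∏_{(R∖D)∖i} z]·∏_D(1 − m u)`,
* `Block.clawh = 1 − claw0` (`P(X_D ≥ 1)`), `Block.clawt = 1 − claw0 − claw1` (`P(X_D ≥ 2)`).
`D = ∅` gives the true block numbers of `Block.real_blockCount_law` (`clawh_empty`, `clawt_empty`); `D ⊇` the loaded anchors gives the fully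
decoupled numbers `(hProd, tProd)` of any `TwoChain` listing the loaded anchors with these marginals and hub laws (`clawh_all`, `clawt_all`, via
the product forms `TwoChain.one_sub_hProd_list`, `TwoChain.hProd_sub_tProd_list`).

THE REDUCTION (`Block.coreLaw_hdom`): decouple the loaded anchors one at a time along a list `ps` (`D_i` = the first `i` of them); if every
step satisfies (M) `clawh D_i ≤ clawh D_{i+1}`, **(A)** `clawt D_{i+1} < q ⟹ (clawh D_{i+1} − q)·claw1 D_i ≤ (clawh D_i − q)·claw1 D_{i+1}`,
**(B)** `q ≤ clawt D_{i+1} ⟹ q ≤ clawt D_i` and the tie-break (T), then the conclusion of `hdom` holds at the exit value `q`: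
`∃ λ ∈ [0,1]: λ·hProd + (1−λ)q ≤ 1 − Σ_R ρ R ∏_R z ∧ λ·tProd + (1−λ)q ≤ 1 − Σ_R ρ R (∏_R z + Σ_{i∈R} s i ∏_{R∖i} z)`.
For the reach law of a pendant CYCLE the steps hold (p1 g21's `TwoChain.cycDec`, re-read through `Block.dominates_of_stepAB`); (M) is Harris'
inequality; (T) is vacuous off a degenerate boundary.  For a GENERAL 2-connected core the steps (A), (B) — and the conclusion itself — can FAIL:
`…QuantFarCoreBlockLocalityFalse` (this seat) certifies the pendant `K₂,₃` (c = pole, sure relays at the three middle vertices, weights `19/40`,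
`9/40`) with `t < min(tProd, q)`.  So this file is the exact law-level CRITERION deciding, core by core, whether the stems-plus-exit transfer of
p1 g19/g22 applies; it is not a route to all cores (memo §0, §9).
[this work]
-/

namespace Summit.CriticalPhenomena.PercolationContinuityZ3.Theorems

namespace Quant

namespace Block

open Finset

/-! ## Product forms of `hProd`, `tProd` along a list -/

namespace TwoChain

/-- `1 − hProd n C = ∏_{i<n} (1 − m_{i+1} u_{i+1})`. [this work] -/
theorem one_sub_hProd (n : ℕ) : ∀ C : TwoChain, 1 - hProd n C = ∏ i ∈ range n, (1 - C.m (i + 1) * C.u (i + 1)) := by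
  induction n with
  | zero => intro C; simp
  | succ n ih =>
    intro C
    have e := ih C.shift
    simp only [shift_m, shift_u] at e
    rw [hProd_succ, Finset.prod_range_succ', ← e, zero_add]
    ring

/-- `hProd n C − tProd n C = Σ_{i<n} m_{i+1} s_{i+1} ∏_{j<n, j≠i} (1 − m_{j+1} u_{j+1})` in recursive form: the pair
`(1 − hProd, hProd − tProd)` obeys `Q1 ↦ m₁s₁·Q0 + (1 − m₁u₁)·Q1`. [this work] -/
theorem hProd_sub_tProd_succ (n : ℕ) (C : TwoChain) :
    hProd (n + 1) C - tProd (n + 1) C = C.m 1 * C.s 1 * (1 - hProd n C.shift) + (1 - C.m 1 * C.u 1) * (hProd n C.shift - tProd n C.shift) := by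
  rw [hProd_succ, tProd_succ]
  unfold u
  ring

end TwoChain

/-! ## The numbers of a partially decoupled core law -/

section Law

variable (J : Finset ℕ) (ρ : Finset ℕ → ℝ) (z s u m : ℕ → ℝ)

/-- `E[∏_{j ∈ R∖D} z j]` — no unit among the still-coupled reached anchors. [this work] -/
noncomputable def clawZ (D : Finset ℕ) : ℝ := ∑ R ∈ J.powerset, ρ R * ∏ j ∈ R \ D, z j

/-- `E[Σ_{i ∈ R∖D} s i ∏_{(R∖D)∖i} z]` — exactly one unit among the still-coupled reached anchors. [this work] -/
noncomputable def clawS (D : Finset ℕ) : ℝ := ∑ R ∈ J.powerset, ρ R * ∑ i ∈ R \ D, s i * ∏ j ∈ (R \ D).erase i, z j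

/-- `∏_{j∈D} (1 − m j u j)` — no unit from the decoupled stems. [this work] -/
noncomputable def stemZ (D : Finset ℕ) : ℝ := ∏ j ∈ D, (1 - m j * u j)

/-- `Σ_{i∈D} m i s i ∏_{D∖i} (1 − m u)` — exactly one unit from the decoupled stems. [this work] -/
noncomputable def stemS (D : Finset ℕ) : ℝ := ∑ i ∈ D, m i * s i * ∏ j ∈ D.erase i, (1 - m j * u j)

/-- `P(X_D = 0)`. [this work] -/
noncomputable def claw0 (D : Finset ℕ) : ℝ := clawZ J ρ z D * stemZ u m D

/-- `P(X_D = 1)`. [this work] -/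
noncomputable def claw1 (D : Finset ℕ) : ℝ := clawZ J ρ z D * stemS s u m D + clawS J ρ z s D * stemZ u m D

/-- `P(X_D ≥ 1)`. [this work] -/
noncomputable def clawh (D : Finset ℕ) : ℝ := 1 - claw0 J ρ z u m D

/-- `P(X_D ≥ 2)`. [this work] -/
noncomputable def clawt (D : Finset ℕ) : ℝ := 1 - claw0 J ρ z u m D - claw1 J ρ z s u m D

/-- Nothing decoupled: `P(X ≥ 1) = 1 − Σ_R ρ R ∏_R z` (the first number of `Block.real_blockCount_law`). [this work] -/
theorem clawh_empty : clawh J ρ z u m ∅ = 1 - ∑ R ∈ J.powerset, ρ R * ∏ j ∈ R, z j := by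
  simp [clawh, claw0, clawZ, stemZ]

/-- Nothing decoupled: `P(X ≥ 2) = 1 − Σ_R ρ R (∏_R z + Σ_{i∈R} s i ∏_{R∖i} z)` (the second number of `Block.real_blockCount_law`). [this work] -/
theorem clawt_empty :
    clawt J ρ z s u m ∅ = 1 - ∑ R ∈ J.powerset, ρ R * (∏ j ∈ R, z j + ∑ i ∈ R, s i * ∏ j ∈ R.erase i, z j) := by
  simp only [clawt, claw0, claw1, clawZ, clawS, stemZ, stemS, sdiff_empty, prod_empty, sum_empty, mul_one, mul_zero, zero_add]
  rw [sub_sub, ← Finset.sum_add_distrib]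
  congr 1
  exact Finset.sum_congr rfl fun R _ => by ring

/-- Everything loaded decoupled: if the anchors of `J` outside `D` deliver no unit (`z = 1`), the coupled factor is `Σ_R ρ R`. [this work] -/
theorem clawZ_all (D : Finset ℕ) (hz : ∀ j ∈ J, j ∉ D → z j = 1) : clawZ J ρ z D = ∑ R ∈ J.powerset, ρ R := by
  unfold clawZ
  refine Finset.sum_congr rfl fun R hR => ?_
  rw [Finset.prod_eq_one (fun j hj => hz j (Finset.mem_powerset.1 hR (Finset.mem_sdiff.1 hj).1) (Finset.mem_sdiff.1 hj).2), mul_one]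

/-- Everything loaded decoupled: if the anchors of `J` outside `D` deliver no unit (`s = 0`), the coupled single factor vanishes. [this work] -/
theorem clawS_all (D : Finset ℕ) (hs : ∀ j ∈ J, j ∉ D → s j = 0) : clawS J ρ z s D = 0 := by
  unfold clawS
  refine Finset.sum_eq_zero fun R hR => ?_
  rw [Finset.sum_eq_zero (fun i hi => ?_), mul_zero]
  rw [hs i (Finset.mem_powerset.1 hR (Finset.mem_sdiff.1 hi).1) (Finset.mem_sdiff.1 hi).2, zero_mul]

/-- Stem factors under `insert`. [this work] -/
theorem stemZ_insert {p : ℕ} {D : Finset ℕ} (hp : p ∉ D) : stemZ u m (insert p D) = (1 - m p * u p) * stemZ u m D := by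
  unfold stemZ; rw [Finset.prod_insert hp]

/-- Stem single factor under `insert`: `S(D + p) = m_p s_p·Z(D) + (1 − m_p u_p)·S(D)`. [this work] -/
theorem stemS_insert {p : ℕ} {D : Finset ℕ} (hp : p ∉ D) :
    stemS s u m (insert p D) = m p * s p * stemZ u m D + (1 - m p * u p) * stemS s u m D := by
  unfold stemS stemZ
  rw [Finset.sum_insert hp, Finset.erase_insert hp, Finset.mul_sum]
  congr 1
  refine Finset.sum_congr rfl fun i hi => ?_
  have hpi : p ≠ i := fun h => hp (h ▸ hi)
  rw [Finset.erase_insert_of_ne hpi, Finset.prod_insert (fun h => hp (Finset.mem_of_mem_erase h))]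
  ring

/-- **The stems of a list are the decoupled chain**: for a duplicate-free list `ps` and any `TwoChain` `C` whose hub `i+1` has marginal
`m (ps[i])` and laws `s (ps[i])`, `u (ps[i])`: `1 − hProd |ps| C = stemZ ps.toFinset` and `hProd − tProd = stemS ps.toFinset`. [this work] -/
theorem stem_eq_chain : ∀ (ps : List ℕ), ps.Nodup → ∀ C : TwoChain,
    (∀ i, i < ps.length → C.m (i + 1) = m (ps.getD i 0) ∧ C.s (i + 1) = s (ps.getD i 0) ∧ C.u (i + 1) = u (ps.getD i 0)) →
    1 - TwoChain.hProd ps.length C = stemZ u m ps.toFinset ∧ TwoChain.hProd ps.length C - TwoChain.tProd ps.length C = stemS s u m ps.toFinset := by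
  intro ps
  induction ps with
  | nil => intro _ C _; simp [stemZ, stemS]
  | cons p ps ih =>
    intro hnd C hC
    have hp : p ∉ ps.toFinset := fun h => (List.nodup_cons.1 hnd).1 (List.mem_toFinset.1 h)
    have hC0 := hC 0 (by simp)
    simp only [List.getD_cons_zero] at hC0
    have hC' : ∀ i, i < ps.length → C.shift.m (i + 1) = m (ps.getD i 0) ∧ C.shift.s (i + 1) = s (ps.getD i 0) ∧ C.shift.u (i + 1) = u (ps.getD i 0) := by
      intro i hi
      have := hC (i + 1) (by simp; omega)
      simpa only [TwoChain.shift_m, TwoChain.shift_s, TwoChain.shift_u, List.getD_cons_succ] using this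
    obtain ⟨ihZ, ihS⟩ := ih (List.nodup_cons.1 hnd).2 C.shift hC'
    simp only [List.length_cons, List.toFinset_cons]
    constructor
    · rw [TwoChain.hProd_succ, stemZ_insert u m hp, ← ihZ, hC0.1, hC0.2.2]; ring
    · rw [TwoChain.hProd_sub_tProd_succ, stemS_insert s u m hp, ← ihZ, ← ihS, hC0.1, hC0.2.1, hC0.2.2]

/-- Everything loaded decoupled, first number: `clawh D = hProd` (for `D = ps.toFinset` with the anchors outside `D` unloaded and `Σ ρ = 1`).
[this work] -/
theorem clawh_all (hρ : ∑ R ∈ J.powerset, ρ R = 1) (ps : List ℕ) (hps : ps.Nodup) (hz : ∀ j ∈ J, j ∉ ps.toFinset → z j = 1)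
    (C : TwoChain) (hC : ∀ i, i < ps.length → C.m (i + 1) = m (ps.getD i 0) ∧ C.s (i + 1) = s (ps.getD i 0) ∧ C.u (i + 1) = u (ps.getD i 0)) :
    clawh J ρ z u m ps.toFinset = TwoChain.hProd ps.length C := by
  obtain ⟨hZ, -⟩ := stem_eq_chain s u m ps hps C hC
  rw [clawh, claw0, clawZ_all J ρ z _ hz, hρ, one_mul, ← hZ]; ring

/-- Everything loaded decoupled, second number: `clawt D = tProd`. [this work] -/
theorem clawt_all (hρ : ∑ R ∈ J.powerset, ρ R = 1) (ps : List ℕ) (hps : ps.Nodup) (hz : ∀ j ∈ J, j ∉ ps.toFinset → z j = 1)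
    (hs : ∀ j ∈ J, j ∉ ps.toFinset → s j = 0)
    (C : TwoChain) (hC : ∀ i, i < ps.length → C.m (i + 1) = m (ps.getD i 0) ∧ C.s (i + 1) = s (ps.getD i 0) ∧ C.u (i + 1) = u (ps.getD i 0)) :
    clawt J ρ z s u m ps.toFinset = TwoChain.tProd ps.length C := by
  obtain ⟨hZ, hS⟩ := stem_eq_chain s u m ps hps C hC
  rw [clawt, claw0, claw1, clawZ_all J ρ z _ hz, clawS_all J ρ z s _ hs, hρ, one_mul, one_mul, zero_mul, add_zero, ← hZ, ← hS]; ring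

/-- **BLOCK-LOCALITY OF FAR(1) FOR AN ARBITRARY PENDANT CORE, REDUCED TO THE ONE-VERTEX STEPS.**  Decouple the loaded anchors along the
duplicate-free list `ps` (`D_i = ` the first `i`); if every step satisfies (M), (A), (B) and the tie-break (T) at the exit value `q ≤ P(X ≥ 1)`,
then the true numbers dominate a mixture of the decoupled numbers `(hProd, tProd)` (of any chain `C` listing the loaded anchors with the
marginals `m` and hub laws `s, u`) and `(q, q)` — the hypothesis `hdom` of `Block.farLayerOne_hubFamily_law` at `q`. [this work] -/
theorem coreLaw_hdom (hρ : ∑ R ∈ J.powerset, ρ R = 1) (ps : List ℕ) (hps : ps.Nodup) (hz : ∀ j ∈ J, j ∉ ps.toFinset → z j = 1)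
    (hs : ∀ j ∈ J, j ∉ ps.toFinset → s j = 0)
    (C : TwoChain) (hC : ∀ i, i < ps.length → C.m (i + 1) = m (ps.getD i 0) ∧ C.s (i + 1) = s (ps.getD i 0) ∧ C.u (i + 1) = u (ps.getD i 0))
    (q : ℝ) (hq : q ≤ clawh J ρ z u m ∅)
    (hM : ∀ i, i < ps.length → clawh J ρ z u m (ps.take i).toFinset ≤ clawh J ρ z u m (ps.take (i + 1)).toFinset)
    (hA : ∀ i, i < ps.length → clawt J ρ z s u m (ps.take (i + 1)).toFinset < q →
      (clawh J ρ z u m (ps.take (i + 1)).toFinset - q) * claw1 J ρ z s u m (ps.take i).toFinset ≤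
        (clawh J ρ z u m (ps.take i).toFinset - q) * claw1 J ρ z s u m (ps.take (i + 1)).toFinset)
    (hB : ∀ i, i < ps.length → q ≤ clawt J ρ z s u m (ps.take (i + 1)).toFinset → q ≤ clawt J ρ z s u m (ps.take i).toFinset)
    (hT : ∀ i, i < ps.length → clawt J ρ z s u m (ps.take (i + 1)).toFinset < q → clawh J ρ z u m (ps.take (i + 1)).toFinset = q →
      clawt J ρ z s u m (ps.take (i + 1)).toFinset ≤ clawt J ρ z s u m (ps.take i).toFinset) :
    ∃ l : ℝ, 0 ≤ l ∧ l ≤ 1 ∧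
      l * TwoChain.hProd ps.length C + (1 - l) * q ≤ 1 - ∑ R ∈ J.powerset, ρ R * ∏ j ∈ R, z j ∧
      l * TwoChain.tProd ps.length C + (1 - l) * q ≤ 1 - ∑ R ∈ J.powerset, ρ R * (∏ j ∈ R, z j + ∑ i ∈ R, s i * ∏ j ∈ R.erase i, z j) := by
  set h : ℕ → ℝ := fun i => clawh J ρ z u m (ps.take i).toFinset with hh
  set t : ℕ → ℝ := fun i => clawt J ρ z s u m (ps.take i).toFinset with ht
  have hP1 : ∀ i, h i - t i = claw1 J ρ z s u m (ps.take i).toFinset := fun i => by simp only [hh, ht, clawh, clawt]; ring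
  have H := dominates_chain q h t ps.length (by simpa [hh] using hq) hM
    (fun i hi hlt => by rw [hP1, hP1]; exact hA i hi hlt) hB hT
  have e0h : h 0 = 1 - ∑ R ∈ J.powerset, ρ R * ∏ j ∈ R, z j := by simp only [hh, List.take_zero, List.toFinset_nil]; exact clawh_empty J ρ z u m
  have e0t : t 0 = 1 - ∑ R ∈ J.powerset, ρ R * (∏ j ∈ R, z j + ∑ i ∈ R, s i * ∏ j ∈ R.erase i, z j) := by
    simp only [ht, List.take_zero, List.toFinset_nil]; exact clawt_empty J ρ z s u m
  have ekh : h ps.length = TwoChain.hProd ps.length C := by simp only [hh, List.take_length]; exact clawh_all J ρ z s u m hρ ps hps hz C hC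
  have ekt : t ps.length = TwoChain.tProd ps.length C := by simp only [ht, List.take_length]; exact clawt_all J ρ z s u m hρ ps hps hz hs C hC
  rw [← e0h, ← e0t, ← ekh, ← ekt]
  exact H

end Law

end Block

end Quant

end Summit.CriticalPhenomena.PercolationContinuityZ3.Theorems
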